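import Summits.Ventures.CertifiedManyBodySolver.Certificates.HubbardSquare_transportClosure_Kit
import HarnessLib

/-!
# Ventures/CertifiedManyBodySolver — Certificates/HubbardSquare_transportClosure_KitT.lean
# (hubbard-fast-reuse-5 g2, cell hubbard-fast, D-0154 (A) CERTIFICATE REUSE: the TRANSPORT-CLOSURE kit, part 3 = the `t'`-LINE laws;
# parts 1/2 = hubbard-fast-reuse-1's `…_Kit.lean` (slices) / `…_KitLaws.lean` (U- and n-line laws); captain p1 g31 RULINGS #20 (b)(i))

Generic one-step TRANSPORT adapters ALONG `t'` for the cell's kernel `e₀` words (surrogate-1 `_mlword_Icc` contract: coordinates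
`θ = ![U/t, t'/t, n]`, floor/cap = 8 literal coefficients on `[1, θ0, θ1, θ2, θ0θ1, θ0θ2, θ1θ2, θ0θ1θ2]`).
The ground-state energy density `e₀(t, s, U, n)` is jointly CONCAVE in the couplings `(s, U)` on `U ≥ 0` at fixed filling
(`energyDensityTT'_ge_convexComb`, [Israel 1979, Thm. I.3.4]); read along `s = t'/t` at fixed `(U, n)` this gives:
* `tc_sliceT_floor/cap` (+ `…_phImage`) — a multilinear word read at a fixed `t' = s₀` is BILINEAR in `(U, n)` (through the exact
  particle–hole map `e(t,s,U,n) = e(t,-s,U,2-n) + U(n-1)` for hole-side words read on the electron side and conversely);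
* `tc_mlFloor_tchord` — `t'`-CHORD FLOOR: bilinear floors `A ≤ e(·,s_A,·,·)`, `B ≤ e(·,s_B,·,·)` (`s_A < s_B`) on a `(U,n)`-rectangle
  give `e ≥ ((s_B − θ1)A + (θ1 − s_A)B)/(s_B − s_A)` for `s_A ≤ θ1 ≤ s_B`; a literal trilinear form below that chord at the eight
  vertices of the target cell is a floor on the cell (the difference is trilinear; vertex rule `trilinear_nonneg_on_Icc₃`);
* `tc_mlCap_tsecx_above` / `tc_mlCap_tsecx_below` — `t'`-SECANT-EXTENSION CAPS: a bilinear cap `e(·,s_B,·,·) ≤ B` and a bilinear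
  floor `A ≤ e(·,s_A,·,·)` at the OTHER end bound the chord slope, whence a cap beyond the capped end:
  `e(θ) ≤ B(θ0,θ2) + (θ1 − s_B)·S` for `θ1 ≥ s_B > s_A` with `(B − A)/(s_B − s_A) ≤ S`, and symmetrically
  `e(θ) ≤ B(θ0,θ2) + (s_B − θ1)·S` for `θ1 ≤ s_B < s_A` (four corner checks each, `bilinear_nonneg_on_rect`).
HONEST FRAMING: bookkeeping adapters; they certify nothing by themselves; every consumer word inherits exactly the hypotheses of
the words it cites; no number of record; not a phase word; no summit statement is proved here; not a superconductivity verdict.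
-/

namespace Summit.Ventures.CertifiedManyBodySolver.Certificates

open Literature.MathematicalPhysics.QuantumLattice
open Literature.MathematicalPhysics.QuantumLattice.ThermodynamicLimit
open Set

/-! ### §1 `t'`-slices of a multilinear word -/

/-- **`t'`-slice of a multilinear word, floor side**: at `t' = s₀` inside the word's box the floor is the bilinear form
`(c₀ + c₂s₀) + (c₁ + c₄s₀) U + (c₃ + c₆s₀) n + (c₅ + c₇s₀) U n` on any sub-rectangle of the word's `(U, n)`-range.
[cite: Rikun1997MultilinearEnvelope, Thm 1.1] -/
theorem tc_sliceT_floor (t : ℝ) {a₀ a₁ a₂ b₀ b₁ b₂ s₀ U₁ U₂ n₁ n₂ : ℝ}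
    {c₀ c₁ c₂ c₃ c₄ c₅ c₆ c₇ d₀ d₁ d₂ d₃ d₄ d₅ d₆ d₇ : ℝ}
    (h : ∀ θ ∈ Set.Icc (![a₀, a₁, a₂] : Fin 3 → ℝ) ![b₀, b₁, b₂],
      c₀ + c₁ * θ 0 + c₂ * θ 1 + c₃ * θ 2 + c₄ * θ 0 * θ 1 + c₅ * θ 0 * θ 2 + c₆ * θ 1 * θ 2 +
          c₇ * θ 0 * θ 1 * θ 2 ≤ energyDensityTT' t (θ 1) (θ 0) (θ 2) ∧
        energyDensityTT' t (θ 1) (θ 0) (θ 2) ≤ d₀ + d₁ * θ 0 + d₂ * θ 1 + d₃ * θ 2 + d₄ * θ 0 * θ 1 +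
          d₅ * θ 0 * θ 2 + d₆ * θ 1 * θ 2 + d₇ * θ 0 * θ 1 * θ 2)
    (hs₁ : a₁ ≤ s₀) (hs₂ : s₀ ≤ b₁) (hU₁ : a₀ ≤ U₁) (hU₂ : U₂ ≤ b₀) (hn₁ : a₂ ≤ n₁) (hn₂ : n₂ ≤ b₂) :
    ∀ U n : ℝ, U₁ ≤ U → U ≤ U₂ → n₁ ≤ n → n ≤ n₂ →
      (c₀ + c₂ * s₀) + (c₁ + c₄ * s₀) * U + (c₃ + c₆ * s₀) * n + (c₅ + c₇ * s₀) * U * n ≤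
        energyDensityTT' t s₀ U n := by
  intro U n k1 k2 k5 k6
  have h₁ := (h ![U, s₀, n] (mem_Icc_vec3_iff.2
    ⟨⟨hU₁.trans k1, k2.trans hU₂⟩, ⟨hs₁, hs₂⟩, ⟨hn₁.trans k5, k6.trans hn₂⟩⟩)).1
  simp only [Matrix.cons_val_zero, Matrix.cons_val_one, Matrix.cons_val] at h₁
  linear_combination h₁

/-- **`t'`-slice of a multilinear word, cap side.** [cite: Rikun1997MultilinearEnvelope, Thm 1.1] -/
theorem tc_sliceT_cap (t : ℝ) {a₀ a₁ a₂ b₀ b₁ b₂ s₀ U₁ U₂ n₁ n₂ : ℝ}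
    {c₀ c₁ c₂ c₃ c₄ c₅ c₆ c₇ d₀ d₁ d₂ d₃ d₄ d₅ d₆ d₇ : ℝ}
    (h : ∀ θ ∈ Set.Icc (![a₀, a₁, a₂] : Fin 3 → ℝ) ![b₀, b₁, b₂],
      c₀ + c₁ * θ 0 + c₂ * θ 1 + c₃ * θ 2 + c₄ * θ 0 * θ 1 + c₅ * θ 0 * θ 2 + c₆ * θ 1 * θ 2 +
          c₇ * θ 0 * θ 1 * θ 2 ≤ energyDensityTT' t (θ 1) (θ 0) (θ 2) ∧
        energyDensityTT' t (θ 1) (θ 0) (θ 2) ≤ d₀ + d₁ * θ 0 + d₂ * θ 1 + d₃ * θ 2 + d₄ * θ 0 * θ 1 +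
          d₅ * θ 0 * θ 2 + d₆ * θ 1 * θ 2 + d₇ * θ 0 * θ 1 * θ 2)
    (hs₁ : a₁ ≤ s₀) (hs₂ : s₀ ≤ b₁) (hU₁ : a₀ ≤ U₁) (hU₂ : U₂ ≤ b₀) (hn₁ : a₂ ≤ n₁) (hn₂ : n₂ ≤ b₂) :
    ∀ U n : ℝ, U₁ ≤ U → U ≤ U₂ → n₁ ≤ n → n ≤ n₂ →
      energyDensityTT' t s₀ U n ≤
        (d₀ + d₂ * s₀) + (d₁ + d₄ * s₀) * U + (d₃ + d₆ * s₀) * n + (d₅ + d₇ * s₀) * U * n := by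
  intro U n k1 k2 k5 k6
  have h₁ := (h ![U, s₀, n] (mem_Icc_vec3_iff.2
    ⟨⟨hU₁.trans k1, k2.trans hU₂⟩, ⟨hs₁, hs₂⟩, ⟨hn₁.trans k5, k6.trans hn₂⟩⟩)).2
  simp only [Matrix.cons_val_zero, Matrix.cons_val_one, Matrix.cons_val] at h₁
  linear_combination h₁

/-- **`t'`-slice through the particle–hole image, floor side**: a word on the box `[a₀,b₀]×[a₁,b₁]×[a₂,b₂]` (`0 < a₂`, `b₂ < 2`)
read at `(U, -s₀, 2 - n)` gives, at `t' = s₀` on the image rectangle `U ∈ [U₁,U₂] ⊆ [a₀,b₀]` (`U₁ ≥ 0`), `n ∈ [n₁,n₂] ⊆ [2-b₂, 2-a₂]`,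
the bilinear floor `P(U,-s₀,2-n) + U(n-1)`. [cite: LiebWuPhysicaA2003, §1 eq. (3)] -/
theorem tc_sliceT_floor_phImage (t : ℝ) {a₀ a₁ a₂ b₀ b₁ b₂ s₀ U₁ U₂ n₁ n₂ : ℝ}
    {c₀ c₁ c₂ c₃ c₄ c₅ c₆ c₇ d₀ d₁ d₂ d₃ d₄ d₅ d₆ d₇ : ℝ}
    (h : ∀ θ ∈ Set.Icc (![a₀, a₁, a₂] : Fin 3 → ℝ) ![b₀, b₁, b₂],
      c₀ + c₁ * θ 0 + c₂ * θ 1 + c₃ * θ 2 + c₄ * θ 0 * θ 1 + c₅ * θ 0 * θ 2 + c₆ * θ 1 * θ 2 +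
          c₇ * θ 0 * θ 1 * θ 2 ≤ energyDensityTT' t (θ 1) (θ 0) (θ 2) ∧
        energyDensityTT' t (θ 1) (θ 0) (θ 2) ≤ d₀ + d₁ * θ 0 + d₂ * θ 1 + d₃ * θ 2 + d₄ * θ 0 * θ 1 +
          d₅ * θ 0 * θ 2 + d₆ * θ 1 * θ 2 + d₇ * θ 0 * θ 1 * θ 2)
    (ha₂ : 0 < a₂) (hb₂ : b₂ < 2) (hU0 : 0 ≤ U₁)
    (hs₁ : a₁ ≤ -s₀) (hs₂ : -s₀ ≤ b₁) (hU₁ : a₀ ≤ U₁) (hU₂ : U₂ ≤ b₀) (hn₁ : 2 - b₂ ≤ n₁) (hn₂ : n₂ ≤ 2 - a₂) :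
    ∀ U n : ℝ, U₁ ≤ U → U ≤ U₂ → n₁ ≤ n → n ≤ n₂ →
      (c₀ + c₂ * (-s₀) + 2 * (c₃ + c₆ * (-s₀))) + ((c₁ + c₄ * (-s₀)) + 2 * (c₅ + c₇ * (-s₀)) - 1) * U +
          (-(c₃ + c₆ * (-s₀))) * n + (1 - (c₅ + c₇ * (-s₀))) * U * n ≤ energyDensityTT' t s₀ U n := by
  intro U n k1 k2 k5 k6
  have h₁ := (h ![U, -s₀, 2 - n] (mem_Icc_vec3_iff.2
    ⟨⟨hU₁.trans k1, k2.trans hU₂⟩, ⟨hs₁, hs₂⟩,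
      ⟨show a₂ ≤ 2 - n by linarith, show 2 - n ≤ b₂ by linarith⟩⟩)).1
  simp only [Matrix.cons_val_zero, Matrix.cons_val_one, Matrix.cons_val] at h₁
  have hph := energyDensityTT'_particleHole t s₀ (hU0.trans k1) (n := n) (by linarith) (by linarith)
  rw [hph]
  linear_combination h₁

/-- **`t'`-slice through the particle–hole image, cap side.** [cite: LiebWuPhysicaA2003, §1 eq. (3)] -/
theorem tc_sliceT_cap_phImage (t : ℝ) {a₀ a₁ a₂ b₀ b₁ b₂ s₀ U₁ U₂ n₁ n₂ : ℝ}
    {c₀ c₁ c₂ c₃ c₄ c₅ c₆ c₇ d₀ d₁ d₂ d₃ d₄ d₅ d₆ d₇ : ℝ}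
    (h : ∀ θ ∈ Set.Icc (![a₀, a₁, a₂] : Fin 3 → ℝ) ![b₀, b₁, b₂],
      c₀ + c₁ * θ 0 + c₂ * θ 1 + c₃ * θ 2 + c₄ * θ 0 * θ 1 + c₅ * θ 0 * θ 2 + c₆ * θ 1 * θ 2 +
          c₇ * θ 0 * θ 1 * θ 2 ≤ energyDensityTT' t (θ 1) (θ 0) (θ 2) ∧
        energyDensityTT' t (θ 1) (θ 0) (θ 2) ≤ d₀ + d₁ * θ 0 + d₂ * θ 1 + d₃ * θ 2 + d₄ * θ 0 * θ 1 +
          d₅ * θ 0 * θ 2 + d₆ * θ 1 * θ 2 + d₇ * θ 0 * θ 1 * θ 2)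
    (ha₂ : 0 < a₂) (hb₂ : b₂ < 2) (hU0 : 0 ≤ U₁)
    (hs₁ : a₁ ≤ -s₀) (hs₂ : -s₀ ≤ b₁) (hU₁ : a₀ ≤ U₁) (hU₂ : U₂ ≤ b₀) (hn₁ : 2 - b₂ ≤ n₁) (hn₂ : n₂ ≤ 2 - a₂) :
    ∀ U n : ℝ, U₁ ≤ U → U ≤ U₂ → n₁ ≤ n → n ≤ n₂ →
      energyDensityTT' t s₀ U n ≤
        (d₀ + d₂ * (-s₀) + 2 * (d₃ + d₆ * (-s₀))) + ((d₁ + d₄ * (-s₀)) + 2 * (d₅ + d₇ * (-s₀)) - 1) * U +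
          (-(d₃ + d₆ * (-s₀))) * n + (1 - (d₅ + d₇ * (-s₀))) * U * n := by
  intro U n k1 k2 k5 k6
  have h₁ := (h ![U, -s₀, 2 - n] (mem_Icc_vec3_iff.2
    ⟨⟨hU₁.trans k1, k2.trans hU₂⟩, ⟨hs₁, hs₂⟩,
      ⟨show a₂ ≤ 2 - n by linarith, show 2 - n ≤ b₂ by linarith⟩⟩)).2
  simp only [Matrix.cons_val_zero, Matrix.cons_val_one, Matrix.cons_val] at h₁
  have hph := energyDensityTT'_particleHole t s₀ (hU0.trans k1) (n := n) (by linarith) (by linarith)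
  rw [hph]
  linear_combination h₁

/-! ### §2 One-step transport laws along `t'` (slice inputs ⇒ literal 8-coefficient output, vertex-checked) -/

/-- **`t'`-CHORD FLOOR** (joint concavity of `e₀` in `(t', U)` on `U ≥ 0`, read along `t'` at fixed `(U, n)`): bilinear floors
`A(U,n) ≤ e(t,s_A,U,n)` and `B(U,n) ≤ e(t,s_B,U,n)` (`s_A < s_B`) on the rectangle `[Ua,Ub] × [n₁,n₂]` (`Ua ≥ 0`) give, for
`s_A ≤ sa ≤ θ1 ≤ sb ≤ s_B`, `e ≥ ((s_B-θ1)A + (θ1-s_A)B)/(s_B-s_A)`; a literal trilinear form `c` below that chord at the eight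
vertices of the target cell is a floor on the cell (the difference is trilinear). [cite: Israel1979, Thm. I.3.4] -/
theorem tc_mlFloor_tchord (t : ℝ) {sA sB Ua Ub sa sb n₁ n₂ α₀ α₁ α₂ α₃ β₀ β₁ β₂ β₃
    c₀ c₁ c₂ c₃ c₄ c₅ c₆ c₇ : ℝ}
    (hUa : 0 ≤ Ua) (hs : sA < sB) (ha : sA ≤ sa) (hb : sb ≤ sB) (hn₁ : 0 ≤ n₁) (hn₂ : n₂ < 2)
    (hA : ∀ U n : ℝ, Ua ≤ U → U ≤ Ub → n₁ ≤ n → n ≤ n₂ →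
      α₀ + α₁ * U + α₂ * n + α₃ * U * n ≤ energyDensityTT' t sA U n)
    (hB : ∀ U n : ℝ, Ua ≤ U → U ≤ Ub → n₁ ≤ n → n ≤ n₂ →
      β₀ + β₁ * U + β₂ * n + β₃ * U * n ≤ energyDensityTT' t sB U n)
    (v₁₁₁ : (c₀ + c₁ * Ua + c₂ * sa + c₃ * n₁ + c₄ * Ua * sa + c₅ * Ua * n₁ + c₆ * sa * n₁ + c₇ * Ua * sa * n₁) * (sB - sA) ≤
      (sB - sa) * (α₀ + α₁ * Ua + α₂ * n₁ + α₃ * Ua * n₁) + (sa - sA) * (β₀ + β₁ * Ua + β₂ * n₁ + β₃ * Ua * n₁))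
    (v₁₁₂ : (c₀ + c₁ * Ua + c₂ * sa + c₃ * n₂ + c₄ * Ua * sa + c₅ * Ua * n₂ + c₆ * sa * n₂ + c₇ * Ua * sa * n₂) * (sB - sA) ≤
      (sB - sa) * (α₀ + α₁ * Ua + α₂ * n₂ + α₃ * Ua * n₂) + (sa - sA) * (β₀ + β₁ * Ua + β₂ * n₂ + β₃ * Ua * n₂))
    (v₁₂₁ : (c₀ + c₁ * Ua + c₂ * sb + c₃ * n₁ + c₄ * Ua * sb + c₅ * Ua * n₁ + c₆ * sb * n₁ + c₇ * Ua * sb * n₁) * (sB - sA) ≤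
      (sB - sb) * (α₀ + α₁ * Ua + α₂ * n₁ + α₃ * Ua * n₁) + (sb - sA) * (β₀ + β₁ * Ua + β₂ * n₁ + β₃ * Ua * n₁))
    (v₁₂₂ : (c₀ + c₁ * Ua + c₂ * sb + c₃ * n₂ + c₄ * Ua * sb + c₅ * Ua * n₂ + c₆ * sb * n₂ + c₇ * Ua * sb * n₂) * (sB - sA) ≤
      (sB - sb) * (α₀ + α₁ * Ua + α₂ * n₂ + α₃ * Ua * n₂) + (sb - sA) * (β₀ + β₁ * Ua + β₂ * n₂ + β₃ * Ua * n₂))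
    (v₂₁₁ : (c₀ + c₁ * Ub + c₂ * sa + c₃ * n₁ + c₄ * Ub * sa + c₅ * Ub * n₁ + c₆ * sa * n₁ + c₇ * Ub * sa * n₁) * (sB - sA) ≤
      (sB - sa) * (α₀ + α₁ * Ub + α₂ * n₁ + α₃ * Ub * n₁) + (sa - sA) * (β₀ + β₁ * Ub + β₂ * n₁ + β₃ * Ub * n₁))
    (v₂₁₂ : (c₀ + c₁ * Ub + c₂ * sa + c₃ * n₂ + c₄ * Ub * sa + c₅ * Ub * n₂ + c₆ * sa * n₂ + c₇ * Ub * sa * n₂) * (sB - sA) ≤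
      (sB - sa) * (α₀ + α₁ * Ub + α₂ * n₂ + α₃ * Ub * n₂) + (sa - sA) * (β₀ + β₁ * Ub + β₂ * n₂ + β₃ * Ub * n₂))
    (v₂₂₁ : (c₀ + c₁ * Ub + c₂ * sb + c₃ * n₁ + c₄ * Ub * sb + c₅ * Ub * n₁ + c₆ * sb * n₁ + c₇ * Ub * sb * n₁) * (sB - sA) ≤
      (sB - sb) * (α₀ + α₁ * Ub + α₂ * n₁ + α₃ * Ub * n₁) + (sb - sA) * (β₀ + β₁ * Ub + β₂ * n₁ + β₃ * Ub * n₁))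
    (v₂₂₂ : (c₀ + c₁ * Ub + c₂ * sb + c₃ * n₂ + c₄ * Ub * sb + c₅ * Ub * n₂ + c₆ * sb * n₂ + c₇ * Ub * sb * n₂) * (sB - sA) ≤
      (sB - sb) * (α₀ + α₁ * Ub + α₂ * n₂ + α₃ * Ub * n₂) + (sb - sA) * (β₀ + β₁ * Ub + β₂ * n₂ + β₃ * Ub * n₂)) :
    ∀ θ ∈ Set.Icc (![Ua, sa, n₁] : Fin 3 → ℝ) ![Ub, sb, n₂],
      c₀ + c₁ * θ 0 + c₂ * θ 1 + c₃ * θ 2 + c₄ * θ 0 * θ 1 + c₅ * θ 0 * θ 2 + c₆ * θ 1 * θ 2 +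
        c₇ * θ 0 * θ 1 * θ 2 ≤ energyDensityTT' t (θ 1) (θ 0) (θ 2) := by
  intro θ hθ
  obtain ⟨⟨k1, k2⟩, ⟨k3, k4⟩, ⟨k5, k6⟩⟩ := mem_Icc_vec3_iff.1 hθ
  have hn0 : 0 ≤ θ 2 := hn₁.trans k5
  have hn2 : θ 2 < 2 := lt_of_le_of_lt k6 hn₂
  have hU0 : 0 ≤ θ 0 := hUa.trans k1
  have hA' := hA (θ 0) (θ 2) k1 k2 k5 k6
  have hB' := hB (θ 0) (θ 2) k1 k2 k5 k6
  have hd : 0 < sB - sA := sub_pos.2 hs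
  have hd0 : sB - sA ≠ 0 := hd.ne'
  set a : ℝ := (sB - θ 1) / (sB - sA) with ha_def
  set b : ℝ := (θ 1 - sA) / (sB - sA) with hb_def
  have ha0 : 0 ≤ a := div_nonneg (by linarith) hd.le
  have hb0 : 0 ≤ b := div_nonneg (by linarith) hd.le
  have hda : (sB - sA) * a = sB - θ 1 := by rw [ha_def]; field_simp
  have hdb : (sB - sA) * b = θ 1 - sA := by rw [hb_def]; field_simp
  have hab : a + b = 1 := by
    have h1 : (sB - sA) * (a + b) = (sB - sA) * 1 := by rw [mul_add, hda, hdb]; ring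
    exact mul_left_cancel₀ hd0 h1
  have hc := energyDensityTT'_ge_convexComb t hn0 hn2 hU0 hU0 ha0 hb0 hab hA' hB'
  have es : a * sA + b * sB = θ 1 := by
    have h1 : (sB - sA) * (a * sA + b * sB) = (sB - sA) * θ 1 := by
      rw [mul_add, ← mul_assoc, ← mul_assoc, hda, hdb]; ring
    exact mul_left_cancel₀ hd0 h1
  have eu : a * θ 0 + b * θ 0 = θ 0 := by rw [← add_mul, hab, one_mul]
  rw [es, eu] at hc
  have h1 : (sB - θ 1) * (α₀ + α₁ * θ 0 + α₂ * θ 2 + α₃ * θ 0 * θ 2) +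
      (θ 1 - sA) * (β₀ + β₁ * θ 0 + β₂ * θ 2 + β₃ * θ 0 * θ 2) ≤
      (sB - sA) * energyDensityTT' t (θ 1) (θ 0) (θ 2) := by
    have h2 := mul_le_mul_of_nonneg_left hc hd.le
    rw [mul_add, ← mul_assoc, ← mul_assoc, hda, hdb] at h2
    exact h2
  have hv := trilinear_nonneg_on_Icc₃ (a₀ := Ua) (a₁ := sa) (a₂ := n₁) (b₀ := Ub) (b₁ := sb) (b₂ := n₂)
    (c₀ := sB * α₀ - sA * β₀ - (sB - sA) * c₀) (c₁ := sB * α₁ - sA * β₁ - (sB - sA) * c₁)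
    (c₂ := -α₀ + β₀ - (sB - sA) * c₂) (c₃ := sB * α₂ - sA * β₂ - (sB - sA) * c₃)
    (c₄ := -α₁ + β₁ - (sB - sA) * c₄) (c₅ := sB * α₃ - sA * β₃ - (sB - sA) * c₅)
    (c₆ := -α₂ + β₂ - (sB - sA) * c₆) (c₇ := -α₃ + β₃ - (sB - sA) * c₇)
    (by linear_combination v₁₁₁) (by linear_combination v₁₁₂) (by linear_combination v₁₂₁)
    (by linear_combination v₁₂₂) (by linear_combination v₂₁₁) (by linear_combination v₂₁₂)
    (by linear_combination v₂₂₁) (by linear_combination v₂₂₂) θ hθ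
  have h3 : (sB - sA) * (c₀ + c₁ * θ 0 + c₂ * θ 1 + c₃ * θ 2 + c₄ * θ 0 * θ 1 + c₅ * θ 0 * θ 2 +
      c₆ * θ 1 * θ 2 + c₇ * θ 0 * θ 1 * θ 2) ≤ (sB - sA) * energyDensityTT' t (θ 1) (θ 0) (θ 2) := by
    linear_combination h1 + hv
  exact le_of_mul_le_mul_left h3 hd

/-- **`t'`-SECANT-EXTENSION CAP, above the capped end** (concavity of `e₀` in `t'` at fixed `(U, n)`): a bilinear floor
`A ≤ e(·,s_A,·,·)` and a bilinear cap `e(·,s_B,·,·) ≤ B` with `s_A < s_B` on `[Ua,Ub] × [n₁,n₂]` (`Ua ≥ 0`) bound the chord slope by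
`(B-A)/(s_B-s_A) ≤ S` (four corner checks), whence `e(θ) ≤ B(θ0,θ2) + (θ1-s_B)S` for `θ1 ≥ s_B`: a cap in the 8-coefficient shape.
[cite: Israel1979, Thm. I.3.4] -/
theorem tc_mlCap_tsecx_above (t : ℝ) {sA sB Ua Ub sa sb n₁ n₂ S α₀ α₁ α₂ α₃ β₀ β₁ β₂ β₃ : ℝ}
    (hUa : 0 ≤ Ua) (hs : sA < sB) (ha : sB ≤ sa) (hn₁ : 0 ≤ n₁) (hn₂ : n₂ < 2)
    (hA : ∀ U n : ℝ, Ua ≤ U → U ≤ Ub → n₁ ≤ n → n ≤ n₂ →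
      α₀ + α₁ * U + α₂ * n + α₃ * U * n ≤ energyDensityTT' t sA U n)
    (hB : ∀ U n : ℝ, Ua ≤ U → U ≤ Ub → n₁ ≤ n → n ≤ n₂ →
      energyDensityTT' t sB U n ≤ β₀ + β₁ * U + β₂ * n + β₃ * U * n)
    (w₁₁ : (β₀ + β₁ * Ua + β₂ * n₁ + β₃ * Ua * n₁) - (α₀ + α₁ * Ua + α₂ * n₁ + α₃ * Ua * n₁) ≤ (sB - sA) * S)
    (w₁₂ : (β₀ + β₁ * Ua + β₂ * n₂ + β₃ * Ua * n₂) - (α₀ + α₁ * Ua + α₂ * n₂ + α₃ * Ua * n₂) ≤ (sB - sA) * S)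
    (w₂₁ : (β₀ + β₁ * Ub + β₂ * n₁ + β₃ * Ub * n₁) - (α₀ + α₁ * Ub + α₂ * n₁ + α₃ * Ub * n₁) ≤ (sB - sA) * S)
    (w₂₂ : (β₀ + β₁ * Ub + β₂ * n₂ + β₃ * Ub * n₂) - (α₀ + α₁ * Ub + α₂ * n₂ + α₃ * Ub * n₂) ≤ (sB - sA) * S) :
    ∀ θ ∈ Set.Icc (![Ua, sa, n₁] : Fin 3 → ℝ) ![Ub, sb, n₂],
      energyDensityTT' t (θ 1) (θ 0) (θ 2) ≤ (β₀ - sB * S) + β₁ * θ 0 + S * θ 1 + β₂ * θ 2 + 0 * θ 0 * θ 1 +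
        β₃ * θ 0 * θ 2 + 0 * θ 1 * θ 2 + 0 * θ 0 * θ 1 * θ 2 := by
  intro θ hθ
  obtain ⟨⟨k1, k2⟩, ⟨k3, _⟩, ⟨k5, k6⟩⟩ := mem_Icc_vec3_iff.1 hθ
  have hn0 : 0 ≤ θ 2 := hn₁.trans k5
  have hn2 : θ 2 < 2 := lt_of_le_of_lt k6 hn₂
  have hU0 : 0 ≤ θ 0 := hUa.trans k1
  have hA' := hA (θ 0) (θ 2) k1 k2 k5 k6
  have hB' := hB (θ 0) (θ 2) k1 k2 k5 k6
  have hw : 0 ≤ ((sB - sA) * S - (β₀ - α₀)) + (-(β₁ - α₁)) * θ 0 + (-(β₂ - α₂)) * θ 2 +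
      (-(β₃ - α₃)) * θ 0 * θ 2 :=
    bilinear_nonneg_on_rect k1 k2 k5 k6 (by linear_combination w₁₁) (by linear_combination w₁₂)
      (by linear_combination w₂₁) (by linear_combination w₂₂)
  rcases eq_or_lt_of_le (ha.trans k3) with h0 | h0
  · rw [← h0]
    linear_combination hB'
  · have hd : 0 < θ 1 - sA := by linarith
    have hd0 : θ 1 - sA ≠ 0 := hd.ne'
    set a : ℝ := (θ 1 - sB) / (θ 1 - sA) with ha_def
    set b : ℝ := (sB - sA) / (θ 1 - sA) with hb_def
    have ha0 : 0 ≤ a := div_nonneg (by linarith) hd.le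
    have hb0 : 0 ≤ b := div_nonneg (by linarith) hd.le
    have hda : (θ 1 - sA) * a = θ 1 - sB := by rw [ha_def]; field_simp
    have hdb : (θ 1 - sA) * b = sB - sA := by rw [hb_def]; field_simp
    have hab : a + b = 1 := by
      have h1 : (θ 1 - sA) * (a + b) = (θ 1 - sA) * 1 := by rw [mul_add, hda, hdb]; ring
      exact mul_left_cancel₀ hd0 h1
    have hc := energyDensityTT'_ge_convexComb t hn0 hn2 hU0 hU0 ha0 hb0 hab hA'
      (le_refl (energyDensityTT' t (θ 1) (θ 0) (θ 2)))
    have es : a * sA + b * θ 1 = sB := by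
      have h1 : (θ 1 - sA) * (a * sA + b * θ 1) = (θ 1 - sA) * sB := by
        rw [mul_add, ← mul_assoc, ← mul_assoc, hda, hdb]; ring
      exact mul_left_cancel₀ hd0 h1
    have eu : a * θ 0 + b * θ 0 = θ 0 := by rw [← add_mul, hab, one_mul]
    rw [es, eu] at hc
    have h1 := hc.trans hB'
    have h2 : (θ 1 - sB) * (α₀ + α₁ * θ 0 + α₂ * θ 2 + α₃ * θ 0 * θ 2) +
        (sB - sA) * energyDensityTT' t (θ 1) (θ 0) (θ 2) ≤
        (θ 1 - sA) * (β₀ + β₁ * θ 0 + β₂ * θ 2 + β₃ * θ 0 * θ 2) := by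
      have h3 := mul_le_mul_of_nonneg_left h1 hd.le
      rw [mul_add, ← mul_assoc, ← mul_assoc, hda, hdb] at h3
      exact h3
    have h3 : (θ 1 - sB) * ((β₀ + β₁ * θ 0 + β₂ * θ 2 + β₃ * θ 0 * θ 2) -
        (α₀ + α₁ * θ 0 + α₂ * θ 2 + α₃ * θ 0 * θ 2)) ≤ (θ 1 - sB) * ((sB - sA) * S) :=
      mul_le_mul_of_nonneg_left (by linear_combination hw) (by linarith)
    have hdS : 0 < sB - sA := sub_pos.2 hs
    have h4 : (sB - sA) * energyDensityTT' t (θ 1) (θ 0) (θ 2) ≤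
        (sB - sA) * ((β₀ - sB * S) + β₁ * θ 0 + S * θ 1 + β₂ * θ 2 + 0 * θ 0 * θ 1 +
          β₃ * θ 0 * θ 2 + 0 * θ 1 * θ 2 + 0 * θ 0 * θ 1 * θ 2) := by
      linear_combination h2 + h3
    exact le_of_mul_le_mul_left h4 hdS

/-- **`t'`-SECANT-EXTENSION CAP, below the capped end** (concavity of `e₀` in `t'` at fixed `(U, n)`): a bilinear cap
`e(·,s_B,·,·) ≤ B` and a bilinear floor `A ≤ e(·,s_A,·,·)` with `s_B < s_A` (the floor now sits at the LARGER `t'`) on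
`[Ua,Ub] × [n₁,n₂]` (`Ua ≥ 0`) give, with `(B-A)/(s_A-s_B) ≤ S` (four corner checks), `e(θ) ≤ B(θ0,θ2) + (s_B-θ1)S` for
`θ1 ≤ s_B`: a cap in the 8-coefficient shape. [cite: Israel1979, Thm. I.3.4] -/
theorem tc_mlCap_tsecx_below (t : ℝ) {sA sB Ua Ub sa sb n₁ n₂ S α₀ α₁ α₂ α₃ β₀ β₁ β₂ β₃ : ℝ}
    (hUa : 0 ≤ Ua) (hs : sB < sA) (hb : sb ≤ sB) (hn₁ : 0 ≤ n₁) (hn₂ : n₂ < 2)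
    (hA : ∀ U n : ℝ, Ua ≤ U → U ≤ Ub → n₁ ≤ n → n ≤ n₂ →
      α₀ + α₁ * U + α₂ * n + α₃ * U * n ≤ energyDensityTT' t sA U n)
    (hB : ∀ U n : ℝ, Ua ≤ U → U ≤ Ub → n₁ ≤ n → n ≤ n₂ →
      energyDensityTT' t sB U n ≤ β₀ + β₁ * U + β₂ * n + β₃ * U * n)
    (w₁₁ : (β₀ + β₁ * Ua + β₂ * n₁ + β₃ * Ua * n₁) - (α₀ + α₁ * Ua + α₂ * n₁ + α₃ * Ua * n₁) ≤ (sA - sB) * S)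
    (w₁₂ : (β₀ + β₁ * Ua + β₂ * n₂ + β₃ * Ua * n₂) - (α₀ + α₁ * Ua + α₂ * n₂ + α₃ * Ua * n₂) ≤ (sA - sB) * S)
    (w₂₁ : (β₀ + β₁ * Ub + β₂ * n₁ + β₃ * Ub * n₁) - (α₀ + α₁ * Ub + α₂ * n₁ + α₃ * Ub * n₁) ≤ (sA - sB) * S)
    (w₂₂ : (β₀ + β₁ * Ub + β₂ * n₂ + β₃ * Ub * n₂) - (α₀ + α₁ * Ub + α₂ * n₂ + α₃ * Ub * n₂) ≤ (sA - sB) * S) :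
    ∀ θ ∈ Set.Icc (![Ua, sa, n₁] : Fin 3 → ℝ) ![Ub, sb, n₂],
      energyDensityTT' t (θ 1) (θ 0) (θ 2) ≤ (β₀ + sB * S) + β₁ * θ 0 + (-S) * θ 1 + β₂ * θ 2 + 0 * θ 0 * θ 1 +
        β₃ * θ 0 * θ 2 + 0 * θ 1 * θ 2 + 0 * θ 0 * θ 1 * θ 2 := by
  intro θ hθ
  obtain ⟨⟨k1, k2⟩, ⟨_, k4⟩, ⟨k5, k6⟩⟩ := mem_Icc_vec3_iff.1 hθ
  have hn0 : 0 ≤ θ 2 := hn₁.trans k5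
  have hn2 : θ 2 < 2 := lt_of_le_of_lt k6 hn₂
  have hU0 : 0 ≤ θ 0 := hUa.trans k1
  have hA' := hA (θ 0) (θ 2) k1 k2 k5 k6
  have hB' := hB (θ 0) (θ 2) k1 k2 k5 k6
  have hw : 0 ≤ ((sA - sB) * S - (β₀ - α₀)) + (-(β₁ - α₁)) * θ 0 + (-(β₂ - α₂)) * θ 2 +
      (-(β₃ - α₃)) * θ 0 * θ 2 :=
    bilinear_nonneg_on_rect k1 k2 k5 k6 (by linear_combination w₁₁) (by linear_combination w₁₂)
      (by linear_combination w₂₁) (by linear_combination w₂₂)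
  rcases eq_or_lt_of_le (k4.trans hb) with h0 | h0
  · rw [h0]
    linear_combination hB'
  · have hd : 0 < sA - θ 1 := by linarith
    have hd0 : sA - θ 1 ≠ 0 := hd.ne'
    set a : ℝ := (sB - θ 1) / (sA - θ 1) with ha_def
    set b : ℝ := (sA - sB) / (sA - θ 1) with hb_def
    have ha0 : 0 ≤ a := div_nonneg (by linarith) hd.le
    have hb0 : 0 ≤ b := div_nonneg (by linarith) hd.le
    have hda : (sA - θ 1) * a = sB - θ 1 := by rw [ha_def]; field_simp
    have hdb : (sA - θ 1) * b = sA - sB := by rw [hb_def]; field_simp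
    have hab : a + b = 1 := by
      have h1 : (sA - θ 1) * (a + b) = (sA - θ 1) * 1 := by rw [mul_add, hda, hdb]; ring
      exact mul_left_cancel₀ hd0 h1
    have hc := energyDensityTT'_ge_convexComb t hn0 hn2 hU0 hU0 ha0 hb0 hab hA'
      (le_refl (energyDensityTT' t (θ 1) (θ 0) (θ 2)))
    have es : a * sA + b * θ 1 = sB := by
      have h1 : (sA - θ 1) * (a * sA + b * θ 1) = (sA - θ 1) * sB := by
        rw [mul_add, ← mul_assoc, ← mul_assoc, hda, hdb]; ring
      exact mul_left_cancel₀ hd0 h1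
    have eu : a * θ 0 + b * θ 0 = θ 0 := by rw [← add_mul, hab, one_mul]
    rw [es, eu] at hc
    have h1 := hc.trans hB'
    have h2 : (sB - θ 1) * (α₀ + α₁ * θ 0 + α₂ * θ 2 + α₃ * θ 0 * θ 2) +
        (sA - sB) * energyDensityTT' t (θ 1) (θ 0) (θ 2) ≤
        (sA - θ 1) * (β₀ + β₁ * θ 0 + β₂ * θ 2 + β₃ * θ 0 * θ 2) := by
      have h3 := mul_le_mul_of_nonneg_left h1 hd.le
      rw [mul_add, ← mul_assoc, ← mul_assoc, hda, hdb] at h3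
      exact h3
    have h3 : (sB - θ 1) * ((β₀ + β₁ * θ 0 + β₂ * θ 2 + β₃ * θ 0 * θ 2) -
        (α₀ + α₁ * θ 0 + α₂ * θ 2 + α₃ * θ 0 * θ 2)) ≤ (sB - θ 1) * ((sA - sB) * S) :=
      mul_le_mul_of_nonneg_left (by linear_combination hw) (by linarith)
    have hdS : 0 < sA - sB := sub_pos.2 hs
    have h4 : (sA - sB) * energyDensityTT' t (θ 1) (θ 0) (θ 2) ≤
        (sA - sB) * ((β₀ + sB * S) + β₁ * θ 0 + (-S) * θ 1 + β₂ * θ 2 + 0 * θ 0 * θ 1 +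
          β₃ * θ 0 * θ 2 + 0 * θ 1 * θ 2 + 0 * θ 0 * θ 1 * θ 2) := by
      linear_combination h2 + h3
    exact le_of_mul_le_mul_left h4 hdS

end Summit.Ventures.CertifiedManyBodySolver.Certificates
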